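import Summits.AtomisticToContinuum.Crystallization.Theorems.ChartedPlanarOrderGapStressCone

/-!
# OverbindingBudget — «GrossMargin»: the gross uniform law is the soft chain at margin two (decomp-a2c lens-4, generation 36)

Helper file (`--supports stmt-AtomisticToContinuum-31280`).  Target: SLOT 1 of the cone of record, `GrossCleanBallsU (1/250) 10` (the
lineage's DECLARED BLOCKER since generation 30: «every μ-ground state at a limiting density with thin cores has, for every `L`, an `L`-ball all
of whose sites pass the relaxed gapped-twelve test `RT a (1/250)` at some admissible spacing `a`»).  Lens: minimal counterexample / extremal
reduction — the SAME hull reduction and energetic cut that reduced the soft law LIOUBᵘ (generations 26–27), made applicable to the gross law by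
one elementary observation.

## §1 The lever: the relaxed test is vacuous at margin two (`rt_of_margin_two`, PROVED)

`RT a t Y y` has three clauses with thresholds `a·63/50 − t`, `a·(1 + 1/50) + t`, `a·(1 − 1/50) − t`.  For `t ≥ 2` and `a ∈ [47/50, 1]` the two
lower thresholds are NEGATIVE, so clauses 1 and 3 hold at every site of every set, and clause 2 («at least twelve other sites within
`a·51/50 + t ≥ 2.9`») holds at every point of every uniformly discrete `9/10`-covering set: the twelve probes `y + 2v`, `v` in the
cuboctahedral kissing pattern, have pairwise distances `≥ 2` and each has a site of `Y` within `9/10`; these twelve sites are distinct, differ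
from `y` and lie within `2.9` of `y`.  HENCE the recurrent clean class at margin `T₁ ≥ 2` IS the gross recurrent class
(`cleanClass_iff_grossClass`: uniformly discrete, rooted, uniformly recurrent, `9/10`-covering, loosened thin cores — NO cleanness), every
law of the soft chain is ANTITONE in its margin (`edgeRelaxationLaw_anti`, `elasticLiouvilleLaw_anti`), and at margin two the soft laws
speak about ALL textures.

## §2 The node (glue PROVED: `grossU_of_liouBallsU`, `grossU_of_ceg_liouville_two`)

    GrossCleanBallsU T₀ D   ⟸   CleanLiouvilleBallsU T₁ D        (any 0 < T₀, any T₁ ≥ 2: LIOUBᵘ at margin two, host a := 1, IS the gross law)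
                            ⟸   EdgeRelaxationLaw T₁ D           (generation 26: hull reduction §E + energetic cut §F, VERBATIM, `0 ≤ T₁`)
                            ⟸   ChargedEnergyGap ∧ LocalRelaxationTest 2 D ∧ ElasticLiouvilleLaw 2 D      (generation 27: mechanism split)

and `LocalRelaxationTest 2 D` is the TREE THEOREM `…ImprovementTransfer.localRelaxationTest_holds`.  NET:

    slot 1  ⟸  ChargedEnergyGap [slot 2, shared crux stmt-14231, already in the cone]  ∧  ElasticLiouvilleLaw 2 10 [«ELAS₂»].

So the blocker's «quantitative pricing of extended defects» (generation-30 census: every road from slot 1 ends at pricing) is discharged BY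
NAME by slot 2: the dense-charge sub-case of a gross strained texture is priced by `ChargedEnergyGap` (`chargeDensityRelax_of_chargedEnergyGap`),
the improvable sub-case by the PROVED local test, the virial-unbalanced sub-case by the PROVED dilation test — none of the three uses cleanness.
What is left, ELAS₂, is the REFERENCE-FREE elastic Liouville law: «a uniformly recurrent, 9/10-covering, thin-cored texture with SPARSE
(1/100)-charge that is LOCALLY OPTIMAL and VIRIAL-BALANCED is not `(t, L)`-strained at every admissible scale unless it has strained cubes».

## §3 The split beneath ELAS₂ (PROVED: `elasticLiouvilleLaw_two_iff_split`) and the new residual «PGL»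

By the case split on «`Y` passes `RT a T₀` everywhere at SOME admissible `a`»:

    ElasticLiouvilleLaw 2 D  ⟺  ElasticLiouvilleLaw T₀ D  ∧  GrossLiouvilleLaw T₀ D        (every T₀ ≤ 2),

where `ElasticLiouvilleLaw (1/250) 10` is EXACTLY the soft residual of generation 27 — discharged (modulo its open leaves) by slots 3–7d of the
cone of record, composed here ONCE as a term: `edgeRelaxationLaw_record_of_slots : [slots 2–7d of cone XXXIX] → EdgeRelaxationLaw (1/250) 10` —
and `GrossLiouvilleLaw T₀ D` («PGL», NEW RESIDUAL) is ELAS₂ restricted to textures with NO admissible global `T₀`-clean scale.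

## §4 Cones (PROVED)

* FOUR-SLOT cone `rdef_of_ceg_liouville_two : ChargedEnergyGap → ElasticLiouvilleLaw 2 10 → CleanlessExcessT → CoherentResidual 10 →
  RobustDefectLimitWindows` (the whole soft chain AND the blocker absorbed into one reference-free elastic law plus slot 2).
* CONE XL `rdef_fortieth_of_recordK_gross_ref` = cone XXXIX (`…ChartedPlanarOrderGapStressCone.rdef_thirtyninth_of_recordK_cert_ref`) with its
  slot 1 `hG : GrossCleanBallsU (1/250) 10` REPLACED by `hPG : GrossLiouvilleLaw (1/250) 10`; all other twenty hypotheses verbatim and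
  load-bearing (they produce `EdgeRelaxationLaw (1/250) 10`, whence the clean half of ELAS₂ and, with `hPG` and slot 2, slot 1 itself).

## §5 Degeneration of the scale split at margin two (PROVED, a warning)

`HasCompressedScale T₁ Y` holds for EVERY uniformly discrete `9/10`-covering `Y` once `T₁ ≥ 2` (`hasCompressedScale_of_two_le`), so
`BalancedLiouvilleLaw T₁ D` is vacuously true (`balancedLiouvilleLaw_of_two_le`) and `CompressedVirialLaw T₁ D` would assert that every gross
recurrent texture is dilation-strained (false-type: hcp).  The generation-28 scale split therefore does NOT transfer to margin two; PGL must be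
attacked reference-free (memo NODE-g36: Cauchy–Born coercivity of charge-free chunks about the Barlow optimum + uniformisation surgery +
scale-variance, plan D1–D4; certificate test I-ELAS2).

Tags (doctrine): `rt_of_margin_two`, class identity, antitonicity, bridges, split, cones — PROVED · ELAS₂ — KERNEL-WEAKER than
`EdgeRelaxationLaw 2 10` (`elasticLiouvilleLaw_of_edgeRelaxationLaw`), EQUIV to slot 1 only modulo slot 2 and two PROVED tests (the ONE
law-currency re-typing, with the split §3 beneath) · PGL — KERNEL-WEAKER than ELAS₂ (`grossLiouvilleLaw_of_elasticLiouvilleLaw_two`),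
WEAKER(evidence) than slot 1: three structural hypotheses added and three sub-cases discharged by name, `e`-free, `μ`-free, the globally-clean
sub-case handed to the soft chain; UNDECIDED (test I-ELAS2); leaf INSTRUMENTABLE / IDEA-NEEDED.
-/

noncomputable section

namespace Summit.AtomisticToContinuum.Crystallization.Theorems.OverbindingBudgetGrossMargin

open Filter Metric Set Topology
open scoped BigOperators
open Literature.MathematicalPhysics.StatisticalMechanics
open Literature.Geometry.DiscreteGeometry (fccKissingPattern card_fccKissingPattern norm_eq_one_of_mem_fccKissingPattern
  one_le_dist_of_mem_fccKissingPattern)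
open Summit.AtomisticToContinuum.Crystallization.Theses.OverbindingBudget (RobustDefectLimitWindows)
open Summit.AtomisticToContinuum.Crystallization.Theses.PricedLinkCensus (ChargedEnergyGap)
open Summit.AtomisticToContinuum.Crystallization.Theorems.ChargedEnergyGapNegative (eStar)
open Summit.AtomisticToContinuum.Crystallization.Theorems.OverbindingBudgetViolatorDensityFloor (RT)
open Summit.AtomisticToContinuum.Crystallization.Theorems.OverbindingBudgetWallTensionLever (ThinCores)
open Summit.AtomisticToContinuum.Crystallization.Theorems.OverbindingBudgetRecurrentSealStatements (UniformlyRecurrent)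
open Summit.AtomisticToContinuum.Crystallization.Theorems.OverbindingBudgetRecurrentDustStatements (ThinCoresL ViolatorsL rt_mono window_finite
  thinCoresL_of_thinCores)
open Summit.AtomisticToContinuum.Crystallization.Theorems.OverbindingBudgetUniformCutStatements (GrossCleanBallsU)
open Summit.AtomisticToContinuum.Crystallization.Theorems.OverbindingBudgetUniformCutDensity (CleanLiouvilleBallsU)
open Summit.AtomisticToContinuum.Crystallization.Theorems.OverbindingBudgetGradedBareness (CleanlessExcessT)
open Summit.AtomisticToContinuum.Crystallization.Theorems.OverbindingBudgetCoherentCut (CoherentResidual)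
open Summit.AtomisticToContinuum.Crystallization.Theorems.OverbindingBudgetEdgeRelaxationStatements (CleanClass EdgeRelaxationLaw StrainedCubes
  RecurrentLiouBallsU)
open Summit.AtomisticToContinuum.Crystallization.Theorems.OverbindingBudgetEdgeRelaxation (liouBallsU_of_recurrent liouBallsU_of_edgeRelaxationLaw
  rdef_of_grossU_edgeRelaxation_coherent rdef_of_grossU_edgeRelaxation_record)
open Summit.AtomisticToContinuum.Crystallization.Theorems.OverbindingBudgetElasticSplitStatements (SparseCharge LocallyOptimal VirialBalanced
  LocalRelaxationTest ElasticLiouvilleLaw elasticLiouvilleLaw_of_edgeRelaxationLaw)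
open Summit.AtomisticToContinuum.Crystallization.Theorems.OverbindingBudgetElasticSplitPricing (edgeRelaxationLaw_of_chargedEnergyGap_local_liouville)
open Summit.AtomisticToContinuum.Crystallization.Theorems.OverbindingBudgetElasticSplitScale (HasCompressedScale CompressedVirialLaw
  BalancedLiouvilleLaw elasticLiouvilleLaw_of_scaleSplit)
open Summit.AtomisticToContinuum.Crystallization.Theorems.OverbindingBudgetElasticSplitShear (ShearFreeLiouvilleLaw
  edgeRelaxationLaw_of_ceg_local_virial_shearFree balancedLiouvilleLaw_of_shearFree)
open Summit.AtomisticToContinuum.Crystallization.Theorems.OverbindingBudgetImprovementTransfer (localRelaxationTest_holds)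
open Summit.AtomisticToContinuum.Crystallization.Theorems.OverbindingBudgetScaleWidening (DoorPeriodicW cleanTwoShellW_of_ballPieces
  chargeFreeBallRigidityW_of_local optimalTexturePeriodic_of_doorPeriodicW)
open Summit.AtomisticToContinuum.Crystallization.Theorems.OverbindingBudgetLimitChargeFreeBall (limitChargeFreeBall_holds)
open Summit.AtomisticToContinuum.Crystallization.Theorems.OverbindingBudgetTwoShellShape (TwoShellShape BarlowGluingW
  localTwoShellRigidityW_of_twoShellShape cleanChartedW_of_gluing)
open Summit.AtomisticToContinuum.Crystallization.Theorems.OverbindingBudgetStackedRigidityW (StackedReductionW)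
open Summit.AtomisticToContinuum.Crystallization.Theorems.OverbindingBudgetEnergyPinning (basalReferenceCP_of_registry
  balancedLayeredCleanU_of_basalP layeredCleanOrStrained_of_balancedU)
open Summit.AtomisticToContinuum.Crystallization.Theorems.OverbindingBudgetPeriodicCleanOrStrained (periodicStrainedCubes_of_layered)
open Summit.AtomisticToContinuum.Crystallization.Theorems.OverbindingBudgetElasticSplitPeriodic (shearFreeLiouvilleLaw_of_periodic)
open Summit.AtomisticToContinuum.Crystallization.Theorems.OverbindingBudgetRegistryCut (RegistryResidual RegistryTube zeroExists_of_residual_tube)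
open Summit.AtomisticToContinuum.Crystallization.Theorems.OverbindingBudgetRegistryDichotomy (BalancedLocus registryLocalisationW_of_geometry_locus
  sqRegistryLocalisationW_of_geometry_height)
open Summit.AtomisticToContinuum.Crystallization.Theorems.OverbindingBudgetRegistryDichotomyCW (RegistryMetricCW)
open Summit.AtomisticToContinuum.Crystallization.Theorems.OverbindingBudgetEnergyTubeBox (RegistryPinningP TubeConvexRefP basalReferenceCP_of_pinningP
  tubeUniquenessRefP_of_tubeConvexRefP basalGapRigidityP_of_uniqRefP)
open Summit.AtomisticToContinuum.Crystallization.Theorems.OverbindingBudgetEnergySquareExtinction (sqRegistryGeometryW_empty sqBalancedHeight_empty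
  sqRegistryMetricCW_empty)
open Summit.AtomisticToContinuum.Crystallization.Theorems.OverbindingBudgetEnergyAffineStraightening (stackedCellPinningU_of_affine)
open Summit.AtomisticToContinuum.Crystallization.Theorems.OverbindingBudgetEnergyAffineFloor (affineStraightenedFloor_of_thin)
open Summit.AtomisticToContinuum.Crystallization.Theorems.OverbindingBudgetEnergyThinProfiles (layerProfileThin_holds)
open Summit.AtomisticToContinuum.Crystallization.Theorems.OverbindingBudgetEnergyAffineTable (AffineTableT AffineTableS affineCellEnergyT_of_table
  affineSquareExtinct_of_table)
open Summit.AtomisticToContinuum.Crystallization.Theorems.OverbindingBudgetEnergyHeightsOsc (CoarseRegistryT CoarseRegistryS ForceCertT ForceCertS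
  stackedHeightsOsc_of_coarse_cert)
open Summit.AtomisticToContinuum.Crystallization.Theorems.OverbindingBudgetEnergyHeightsOscCone (registryGeometryW_of_coarse)
open Summit.AtomisticToContinuum.Crystallization.Theorems.ChartedPlanarOrderGapStressVanishes (gapStressVanishesW_holds)
open Summit.AtomisticToContinuum.Crystallization.Theorems.ChartedPlanarOrderGapStressCone (rdef_thirtyninth_of_recordK_cert_ref)

/-! ## §1  The relaxed test is vacuous at margin two -/

/-- The twelve probes `y + 2v`, `v` in the cuboctahedral kissing pattern, are at distance `2` from `y`. [this file] -/
theorem dist_probe {y v : EuclideanSpace ℝ (Fin 3)} (hv : v ∈ fccKissingPattern) : dist y (y + (2 : ℝ) • v) = 2 := by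
  rw [dist_comm, dist_eq_norm, add_sub_cancel_left, norm_smul, norm_eq_one_of_mem_fccKissingPattern hv,
    Real.norm_of_nonneg (by norm_num : (0 : ℝ) ≤ 2), mul_one]

/-- Distinct probes are at distance `≥ 2`. [this file] -/
theorem two_le_dist_probe {y u v : EuclideanSpace ℝ (Fin 3)} (hu : u ∈ fccKissingPattern) (hv : v ∈ fccKissingPattern) (huv : u ≠ v) :
    2 ≤ dist (y + (2 : ℝ) • u) (y + (2 : ℝ) • v) := by
  rw [dist_add_left, dist_smul₀, Real.norm_of_nonneg (by norm_num : (0 : ℝ) ≤ 2)]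
  linarith [one_le_dist_of_mem_fccKissingPattern hu hv huv]

/-- **Every point of a uniformly discrete `9/10`-covering set has at least twelve other sites within `29/10`.** [this file] -/
theorem twelve_le_ncard_window {Y : Set (EuclideanSpace ℝ (Fin 3))} (hY : UniformlyDiscrete Y)
    (hcov : ∀ z : EuclideanSpace ℝ (Fin 3), ∃ w ∈ Y, dist z w ≤ 9 / 10) (y : EuclideanSpace ℝ (Fin 3)) {r : ℝ} (hr : 29 / 10 ≤ r) :
    12 ≤ {w ∈ Y | w ≠ y ∧ dist y w ≤ r}.ncard := by
  classical
  choose g hgY hgd using hcov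
  set S : Finset (EuclideanSpace ℝ (Fin 3)) := fccKissingPattern.image fun v => g (y + (2 : ℝ) • v) with hS
  have hinj : Set.InjOn (fun v => g (y + (2 : ℝ) • v)) ↑fccKissingPattern := by
    intro u hu v hv huv
    have huv' : g (y + (2 : ℝ) • u) = g (y + (2 : ℝ) • v) := huv
    by_contra hne
    have h3 := two_le_dist_probe (y := y) (Finset.mem_coe.1 hu) (Finset.mem_coe.1 hv) hne
    have h5 : dist (g (y + (2 : ℝ) • u)) (y + (2 : ℝ) • v) ≤ 9 / 10 := by
      rw [huv', dist_comm]; exact hgd _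
    linarith [dist_triangle (y + (2 : ℝ) • u) (g (y + (2 : ℝ) • u)) (y + (2 : ℝ) • v), hgd (y + (2 : ℝ) • u)]
  have hcard : S.card = 12 := by
    rw [hS, Finset.card_image_of_injOn hinj, card_fccKissingPattern]
  have hsub : (↑S : Set (EuclideanSpace ℝ (Fin 3))) ⊆ {w ∈ Y | w ≠ y ∧ dist y w ≤ r} := by
    intro w hw
    obtain ⟨v, hv, rfl⟩ := Finset.mem_image.1 (Finset.mem_coe.1 hw)
    refine ⟨hgY _, ?_, ?_⟩
    · intro h
      have h1 := hgd (y + (2 : ℝ) • v)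
      rw [h, dist_comm, dist_probe hv] at h1
      norm_num at h1
    · have h1 := dist_triangle y (y + (2 : ℝ) • v) (g (y + (2 : ℝ) • v))
      rw [dist_probe hv] at h1
      linarith [hgd (y + (2 : ℝ) • v)]
  calc 12 = S.card := hcard.symm
    _ = (↑S : Set (EuclideanSpace ℝ (Fin 3))).ncard := (Set.ncard_coe_finset S).symm
    _ ≤ {w ∈ Y | w ≠ y ∧ dist y w ≤ r}.ncard := Set.ncard_le_ncard hsub (window_finite hY y r)

/-- **THE LEVER.  The relaxed gapped-twelve test `RT a t` is VACUOUS at margin `t ≥ 2`**: at every admissible spacing `a ∈ [47/50, 1]` it is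
passed by EVERY point of every uniformly discrete `9/10`-covering set. [this file] -/
theorem rt_of_margin_two {Y : Set (EuclideanSpace ℝ (Fin 3))} (hY : UniformlyDiscrete Y)
    (hcov : ∀ z : EuclideanSpace ℝ (Fin 3), ∃ w ∈ Y, dist z w ≤ 9 / 10) {a t : ℝ} (ha : 47 / 50 ≤ a) (ha' : a ≤ 1) (ht : 2 ≤ t)
    (y : EuclideanSpace ℝ (Fin 3)) : RT a t Y y := by
  refine ⟨?_, twelve_le_ncard_window hY hcov y (by linarith), fun w _ _ => ⟨?_, Or.inr ?_⟩⟩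
  · have h0 : {w ∈ Y | w ≠ y ∧ dist y w < a * (63 / 50) - t} = ∅ := by
      refine Set.eq_empty_iff_forall_notMem.2 fun w hw => ?_
      have h1 := hw.2.2
      linarith [dist_nonneg (x := y) (y := w)]
    rw [h0, Set.ncard_empty]; norm_num
  · linarith [dist_nonneg (x := y) (y := w)]
  · linarith [dist_nonneg (x := y) (y := w)]

/-! ## §2  The clean class at margin two is the gross class; antitonicity of the soft laws -/

/-- **The gross recurrent class `GrossClass D Y`**: uniformly discrete, rooted, uniformly recurrent, `9/10`-covering, loosened thin cores of
radius `D` at some admissible host spacing — `CleanClass T₀ D Y` WITHOUT its cleanness clause. [piece] -/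
def GrossClass (D : ℝ) (Y : Set (EuclideanSpace ℝ (Fin 3))) : Prop :=
  UniformlyDiscrete Y ∧ (0 : EuclideanSpace ℝ (Fin 3)) ∈ Y ∧ UniformlyRecurrent Y ∧
    (∀ z : EuclideanSpace ℝ (Fin 3), ∃ w ∈ Y, dist z w ≤ 9 / 10) ∧
    ∃ b : ℝ, 47 / 50 ≤ b ∧ b ≤ 1 ∧ ThinCoresL b D Y

/-- The clean class is contained in the gross class. [this file] -/
theorem grossClass_of_cleanClass {T₀ D : ℝ} {Y : Set (EuclideanSpace ℝ (Fin 3))} (h : CleanClass T₀ D Y) : GrossClass D Y :=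
  ⟨h.1, h.2.1, h.2.2.1, h.2.2.2.1, h.2.2.2.2.1⟩

/-- At margin `T₁ ≥ 2` every gross texture is in the clean class (witness spacing `a := 1`). [this file] -/
theorem cleanClass_of_grossClass {T₁ D : ℝ} {Y : Set (EuclideanSpace ℝ (Fin 3))} (hT₁ : 2 ≤ T₁) (h : GrossClass D Y) : CleanClass T₁ D Y :=
  ⟨h.1, h.2.1, h.2.2.1, h.2.2.2.1, h.2.2.2.2, 1, by norm_num, le_rfl, fun y _ => rt_of_margin_two h.1 h.2.2.2.1 (by norm_num) le_rfl hT₁ y⟩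

/-- **`CleanClass T₁ D = GrossClass D` for `T₁ ≥ 2`.** [this file] -/
theorem cleanClass_iff_grossClass {T₁ D : ℝ} {Y : Set (EuclideanSpace ℝ (Fin 3))} (hT₁ : 2 ≤ T₁) : CleanClass T₁ D Y ↔ GrossClass D Y :=
  ⟨grossClass_of_cleanClass, cleanClass_of_grossClass hT₁⟩

/-- The clean class grows with the margin. [this file] -/
theorem cleanClass_mono {T₀ T₁ D : ℝ} {Y : Set (EuclideanSpace ℝ (Fin 3))} (hT : T₀ ≤ T₁) (h : CleanClass T₀ D Y) : CleanClass T₁ D Y := by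
  obtain ⟨hUD, h0, hR, hcov, hb, a, ha1, ha2, hRT⟩ := h
  exact ⟨hUD, h0, hR, hcov, hb, a, ha1, ha2, fun y hy => rt_mono hUD hT (hRT y hy)⟩

/-- RELAX is antitone in the margin. [this file] -/
theorem edgeRelaxationLaw_anti {T₀ T₁ D : ℝ} (hT : T₀ ≤ T₁) (h : EdgeRelaxationLaw T₁ D) : EdgeRelaxationLaw T₀ D :=
  fun Y hY t ht L hv => h Y (cleanClass_mono hT hY) t ht L hv

/-- The elastic Liouville law is antitone in the margin. [this file] -/
theorem elasticLiouvilleLaw_anti {T₀ T₁ D : ℝ} (hT : T₀ ≤ T₁) (h : ElasticLiouvilleLaw T₁ D) : ElasticLiouvilleLaw T₀ D :=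
  fun Y hY hS hL hV t ht L hv => h Y (cleanClass_mono hT hY) hS hL hV t ht L hv

/-- Above margin two the margin is immaterial. [this file] -/
theorem elasticLiouvilleLaw_iff_two {T₁ D : ℝ} (hT₁ : 2 ≤ T₁) : ElasticLiouvilleLaw T₁ D ↔ ElasticLiouvilleLaw 2 D :=
  ⟨elasticLiouvilleLaw_anti hT₁, fun h Y hY => h Y (cleanClass_of_grossClass le_rfl (grossClass_of_cleanClass hY))⟩

/-- Above margin two the margin of RELAX is immaterial. [this file] -/
theorem edgeRelaxationLaw_iff_two {T₁ D : ℝ} (hT₁ : 2 ≤ T₁) : EdgeRelaxationLaw T₁ D ↔ EdgeRelaxationLaw 2 D :=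
  ⟨edgeRelaxationLaw_anti hT₁, fun h Y hY => h Y (cleanClass_of_grossClass le_rfl (grossClass_of_cleanClass hY))⟩

/-- **Readable pin of «ELAS₂»**: the reference-free elastic Liouville law on the gross recurrent class. [this file] -/
theorem elasticLiouvilleLaw_two_iff_gross {D : ℝ} : ElasticLiouvilleLaw 2 D ↔
    ∀ Y : Set (EuclideanSpace ℝ (Fin 3)), GrossClass D Y → SparseCharge Y → LocallyOptimal Y → VirialBalanced Y →
      ∀ t : ℝ, 0 < t → ∀ L : ℝ, (∀ a' : ℝ, 47 / 50 ≤ a' → a' ≤ 1 → ViolatorsL a' t L Y) → ∃ κ : ℝ, 0 < κ ∧ StrainedCubes κ Y :=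
  ⟨fun h Y hY => h Y (cleanClass_of_grossClass le_rfl hY), fun h Y hY => h Y (grossClass_of_cleanClass hY)⟩

/-! ## §3  The split beneath ELAS₂: globally clean (soft residual) / properly gross (new residual «PGL») -/

/-- **The properly-gross elastic Liouville law `GrossLiouvilleLaw T₀ D`** («PGL», NEW RESIDUAL): ELAS₂ restricted to textures of the gross
recurrent class that pass the relaxed test `RT a T₀` everywhere at NO admissible spacing `a`. [piece] -/
def GrossLiouvilleLaw (T₀ D : ℝ) : Prop :=
  ∀ Y : Set (EuclideanSpace ℝ (Fin 3)), GrossClass D Y → (¬ ∃ a : ℝ, 47 / 50 ≤ a ∧ a ≤ 1 ∧ ∀ y ∈ Y, RT a T₀ Y y) →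
    SparseCharge Y → LocallyOptimal Y → VirialBalanced Y →
      ∀ t : ℝ, 0 < t → ∀ L : ℝ, (∀ a' : ℝ, 47 / 50 ≤ a' → a' ≤ 1 → ViolatorsL a' t L Y) → ∃ κ : ℝ, 0 < κ ∧ StrainedCubes κ Y

/-- KERNEL-WEAKER certificate: PGL is a restriction of ELAS₂. [this file] -/
theorem grossLiouvilleLaw_of_elasticLiouvilleLaw_two {T₀ D : ℝ} (h : ElasticLiouvilleLaw 2 D) : GrossLiouvilleLaw T₀ D :=
  fun Y hY _ => h Y (cleanClass_of_grossClass le_rfl hY)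

/-- … hence of RELAX at margin two. [this file] -/
theorem grossLiouvilleLaw_of_edgeRelaxationLaw_two {T₀ D : ℝ} (h : EdgeRelaxationLaw 2 D) : GrossLiouvilleLaw T₀ D :=
  grossLiouvilleLaw_of_elasticLiouvilleLaw_two (elasticLiouvilleLaw_of_edgeRelaxationLaw h)

/-- PGL is monotone in its margin (a larger margin excludes more textures). [this file] -/
theorem grossLiouvilleLaw_mono {T₀ T₁ D : ℝ} (hT : T₀ ≤ T₁) (h : GrossLiouvilleLaw T₀ D) : GrossLiouvilleLaw T₁ D :=
  fun Y hY hn => h Y hY fun ⟨a, ha1, ha2, hRT⟩ => hn ⟨a, ha1, ha2, fun y hy => rt_mono hY.1 hT (hRT y hy)⟩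

/-- **The split (glue PROVED)**: ELAS at margin `T₀` on the globally `T₀`-clean textures and PGL on the rest give ELAS₂. [this file] -/
theorem elasticLiouvilleLaw_two_of_split {T₀ D : ℝ} (hE : ElasticLiouvilleLaw T₀ D) (hG : GrossLiouvilleLaw T₀ D) : ElasticLiouvilleLaw 2 D := by
  intro Y hY hS hL hV t ht L hv
  by_cases hc : ∃ a : ℝ, 47 / 50 ≤ a ∧ a ≤ 1 ∧ ∀ y ∈ Y, RT a T₀ Y y
  · exact hE Y ⟨hY.1, hY.2.1, hY.2.2.1, hY.2.2.2.1, hY.2.2.2.2.1, hc⟩ hS hL hV t ht L hv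
  · exact hG Y (grossClass_of_cleanClass hY) hc hS hL hV t ht L hv

/-- **`ElasticLiouvilleLaw 2 D ⟺ ElasticLiouvilleLaw T₀ D ∧ GrossLiouvilleLaw T₀ D`** (`T₀ ≤ 2`). [this file] -/
theorem elasticLiouvilleLaw_two_iff_split {T₀ D : ℝ} (hT₀ : T₀ ≤ 2) :
    ElasticLiouvilleLaw 2 D ↔ ElasticLiouvilleLaw T₀ D ∧ GrossLiouvilleLaw T₀ D :=
  ⟨fun h => ⟨elasticLiouvilleLaw_anti hT₀ h, grossLiouvilleLaw_of_elasticLiouvilleLaw_two h⟩, fun h => elasticLiouvilleLaw_two_of_split h.1 h.2⟩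

/-! ## §4  Slot 1 from the soft chain at margin two -/

/-- **LIOUBᵘ at margin `T₁ ≥ 2` IS the gross uniform law** (any target margin `T₀ > 0`; host spacing `a := 1`, loosened thin cores). [this file] -/
theorem grossU_of_liouBallsU {T₀ T₁ D : ℝ} (hT₀ : 0 < T₀) (hT₁ : 2 ≤ T₁) (h : CleanLiouvilleBallsU T₁ D) : GrossCleanBallsU T₀ D := by
  intro e hT hlb Y hUD hcov hμ b hb1 hb2 hthin L
  have hcov' : ∀ z : EuclideanSpace ℝ (Fin 3), ∃ w ∈ Y, dist z w ≤ 9 / 10 := fun z => (hcov z).imp fun w hw => ⟨hw.1, hw.2.le⟩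
  exact h e hT hlb Y hUD hcov' hμ b hb1 hb2 (thinCoresL_of_thinCores hb1 hthin) 1 (by norm_num) le_rfl
    (fun y _ => rt_of_margin_two hUD hcov' (by norm_num) le_rfl hT₁ y) T₀ hT₀ L

/-- … from the recurrent Liouville law at margin `T₁ ≥ 2` (generation-26 hull reduction, verbatim). [this file] -/
theorem grossU_of_recurrentLiou {T₀ T₁ D : ℝ} (hT₀ : 0 < T₀) (hT₁ : 2 ≤ T₁) (h : RecurrentLiouBallsU T₁ D) : GrossCleanBallsU T₀ D :=
  grossU_of_liouBallsU hT₀ hT₁ (liouBallsU_of_recurrent (by linarith) h)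

/-- … from RELAX at margin `T₁ ≥ 2` (generation-26 energetic cut, verbatim). [this file] -/
theorem grossU_of_edgeRelaxationLaw {T₀ T₁ D : ℝ} (hT₀ : 0 < T₀) (hT₁ : 2 ≤ T₁) (h : EdgeRelaxationLaw T₁ D) : GrossCleanBallsU T₀ D :=
  grossU_of_liouBallsU hT₀ hT₁ (liouBallsU_of_edgeRelaxationLaw (by linarith) h)

/-- **THE NODE: slot 1 ⟸ slot 2 ∧ ELAS₂** — `GrossCleanBallsU T₀ D ⟸ ChargedEnergyGap ∧ ElasticLiouvilleLaw 2 D` (generation-27 mechanism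
split at margin two; its local test is the tree theorem `localRelaxationTest_holds`). [this file] -/
theorem grossU_of_ceg_liouville_two {T₀ D : ℝ} (hT₀ : 0 < T₀) (hCEG : ChargedEnergyGap) (hE : ElasticLiouvilleLaw 2 D) : GrossCleanBallsU T₀ D :=
  grossU_of_edgeRelaxationLaw hT₀ le_rfl (edgeRelaxationLaw_of_chargedEnergyGap_local_liouville hCEG (localRelaxationTest_holds 2 D) hE)

/-- Slot 1 from slot 2, the soft residual at margin `T₁` and PGL at margin `T₁`. [this file] -/
theorem grossU_of_ceg_split {T₀ T₁ D : ℝ} (hT₀ : 0 < T₀) (hCEG : ChargedEnergyGap) (hE : ElasticLiouvilleLaw T₁ D) (hG : GrossLiouvilleLaw T₁ D) :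
    GrossCleanBallsU T₀ D :=
  grossU_of_ceg_liouville_two hT₀ hCEG (elasticLiouvilleLaw_two_of_split hE hG)

/-! ## §5  The soft product of the cone of record, composed once: slots 2–7d ⟹ `EdgeRelaxationLaw (1/250) 10` -/

/-- **Slots 2–7d of cone XXXIX give RELAX at the record margin** (the per-level lemmas of generations 15–38 and lens-3 g26, composed). [this file] -/
theorem edgeRelaxationLaw_record_of_slots (s₁ s₂ h₀ h₁ τ' τ'' κ' ω₀ ω B : ℝ) (s₀ : ℕ) (hκ' : 0 < κ') (hω : 0 < ω) (hω₀ : 2 * ω₀ ≤ ω)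
    (hs₀ : 4 ≤ s₀) (hs₁ : 0 ≤ s₁) (hs : 289 * s₂ ^ 2 ≤ 388 * s₁ ^ 2) (hCEG : ChargedEnergyGap) (hC : CompressedVirialLaw (1 / 250) 10)
    (hS : TwoShellShape (1 / 100) (3 / 50) (1 / 450)) (hB₂ : BarlowGluingW) (hD : DoorPeriodicW 2) (hSR : StackedReductionW 2 (17 / 16))
    (hP : RegistryPinningP (17 / 16) (1 / 40) (3 / 16) s₁ s₂ 1 0) (hT : TubeConvexRefP (17 / 16) (1 / 40) s₁ s₂ 1 0)
    (hCT : CoarseRegistryT (17 / 16) h₀ (3 / 20)) (hFT : ForceCertT h₀ (3 / 20) τ' ω₀) (hCS : CoarseRegistryS (17 / 16) h₁ (3 / 20))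
    (hFS : ForceCertS h₁ (3 / 20) τ'' ω₀) (hTT : AffineTableT (17 / 16) s₁ s₂ ω s₀ B (eStar + 2 * κ'))
    (hTS : AffineTableS (17 / 16) ω s₀ B (eStar + 2 * κ')) (hBal : BalancedLocus s₁ s₂ h₀ (1 / 40)) (hR1 : RegistryResidual s₁ s₂ (1 / 250))
    (hR2 : RegistryTube s₁ s₂ (1 / 100) 1) (hMet : RegistryMetricCW s₁ s₂ (3 / 500)) : EdgeRelaxationLaw (1 / 250) 10 := by
  have h₁ := cleanTwoShellW_of_ballPieces (limitChargeFreeBall_holds (1 / 250) 10)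
    (chargeFreeBallRigidityW_of_local (by norm_num) (localTwoShellRigidityW_of_twoShellShape le_rfl hS))
  have h₂ := cleanChartedW_of_gluing (T₀ := 1 / 250) (D := 10) hB₂
  have hPin := stackedCellPinningU_of_affine hκ' le_rfl hs₀ (affineStraightenedFloor_of_thin le_rfl (layerProfileThin_holds le_rfl))
    (stackedHeightsOsc_of_coarse_cert le_rfl hω₀ hCT hFT hCS hFS) (affineCellEnergyT_of_table hω hTT) (affineSquareExtinct_of_table hω hTS)
  have hGeo := registryGeometryW_of_coarse hs₁ hs hCT
  have hLoc := registryLocalisationW_of_geometry_locus (r' := 7 / 40) (by norm_num) hGeo hBal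
  have hEx := zeroExists_of_residual_tube (r'' := 3 / 500) (by norm_num) (by norm_num) (by norm_num) (by norm_num) (by norm_num) (by norm_num)
    hR1 hR2
  have hSqLoc := sqRegistryLocalisationW_of_geometry_height (rₛ := 4 / 25) (by norm_num) (sqRegistryGeometryW_empty (17 / 16) 0 (3 / 20))
    (sqBalancedHeight_empty 0 (1 / 100))
  have hBR := basalReferenceCP_of_registry (ρ₁ := 3 / 16) (by norm_num) (by norm_num) le_rfl (by norm_num) hLoc hEx hMet hSqLoc
    (sqRegistryMetricCW_empty 0 (1 / 100) 0)
  have hR := basalGapRigidityP_of_uniqRefP (tubeUniquenessRefP_of_tubeConvexRefP hT) (basalReferenceCP_of_pinningP hBR hP)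
  have hB := balancedLayeredCleanU_of_basalP hSR gapStressVanishesW_holds hPin hR
  have hSF := shearFreeLiouvilleLaw_of_periodic (optimalTexturePeriodic_of_doorPeriodicW h₁ h₂ hD)
    (periodicStrainedCubes_of_layered (by norm_num) (layeredCleanOrStrained_of_balancedU (by norm_num) h₁ hB))
  exact edgeRelaxationLaw_of_ceg_local_virial_shearFree hCEG (localRelaxationTest_holds _ _) hC hSF

/-! ## §6  Cones -/

/-- **FOUR-SLOT CONE**: `ChargedEnergyGap → ElasticLiouvilleLaw 2 10 → CleanlessExcessT → CoherentResidual 10 → RobustDefectLimitWindows`. [this file] -/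
theorem rdef_of_ceg_liouville_two (hCEG : ChargedEnergyGap) (hE₂ : ElasticLiouvilleLaw 2 10) (hCE : CleanlessExcessT) (hRes : CoherentResidual 10) :
    RobustDefectLimitWindows :=
  rdef_of_grossU_edgeRelaxation_coherent (T₀ := 2) (by norm_num) (grossU_of_ceg_liouville_two (by norm_num) hCEG hE₂)
    (edgeRelaxationLaw_of_chargedEnergyGap_local_liouville hCEG (localRelaxationTest_holds 2 10) hE₂) hCE hRes

/-- The four-slot cone with ELAS₂ split at the record margin: `ChargedEnergyGap → ElasticLiouvilleLaw (1/250) 10 → GrossLiouvilleLaw (1/250) 10 →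
CleanlessExcessT → CoherentResidual 10 → RobustDefectLimitWindows`. [this file] -/
theorem rdef_of_ceg_liouville_split (hCEG : ChargedEnergyGap) (hE : ElasticLiouvilleLaw (1 / 250) 10) (hPG : GrossLiouvilleLaw (1 / 250) 10)
    (hCE : CleanlessExcessT) (hRes : CoherentResidual 10) : RobustDefectLimitWindows :=
  rdef_of_ceg_liouville_two hCEG (elasticLiouvilleLaw_two_of_split hE hPG) hCE hRes

/-- **CONE XL** — cone XXXIX with its slot 1 `GrossCleanBallsU (1/250) 10` (the declared BLOCKER) REPLACED by the properly-gross elastic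
Liouville law `GrossLiouvilleLaw (1/250) 10`; the other twenty hypotheses verbatim and load-bearing. [this file] -/
theorem rdef_fortieth_of_recordK_gross_ref (s₁ s₂ h₀ h₁ τ' τ'' κ' ω₀ ω B : ℝ) (s₀ : ℕ) (hκ' : 0 < κ') (hω : 0 < ω) (hω₀ : 2 * ω₀ ≤ ω)
    (hs₀ : 4 ≤ s₀) (hs₁ : 0 ≤ s₁) (hs : 289 * s₂ ^ 2 ≤ 388 * s₁ ^ 2) (hPG : GrossLiouvilleLaw (1 / 250) 10) (hCEG : ChargedEnergyGap)
    (hC : CompressedVirialLaw (1 / 250) 10) (hS : TwoShellShape (1 / 100) (3 / 50) (1 / 450)) (hB₂ : BarlowGluingW) (hD : DoorPeriodicW 2)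
    (hSR : StackedReductionW 2 (17 / 16)) (hP : RegistryPinningP (17 / 16) (1 / 40) (3 / 16) s₁ s₂ 1 0)
    (hT : TubeConvexRefP (17 / 16) (1 / 40) s₁ s₂ 1 0) (hCT : CoarseRegistryT (17 / 16) h₀ (3 / 20)) (hFT : ForceCertT h₀ (3 / 20) τ' ω₀)
    (hCS : CoarseRegistryS (17 / 16) h₁ (3 / 20)) (hFS : ForceCertS h₁ (3 / 20) τ'' ω₀)
    (hTT : AffineTableT (17 / 16) s₁ s₂ ω s₀ B (eStar + 2 * κ')) (hTS : AffineTableS (17 / 16) ω s₀ B (eStar + 2 * κ'))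
    (hBal : BalancedLocus s₁ s₂ h₀ (1 / 40)) (hR1 : RegistryResidual s₁ s₂ (1 / 250)) (hR2 : RegistryTube s₁ s₂ (1 / 100) 1)
    (hMet : RegistryMetricCW s₁ s₂ (3 / 500)) (hCE : CleanlessExcessT) (hRes : CoherentResidual 10) : RobustDefectLimitWindows :=
  have hERL := edgeRelaxationLaw_record_of_slots s₁ s₂ h₀ h₁ τ' τ'' κ' ω₀ ω B s₀ hκ' hω hω₀ hs₀ hs₁ hs hCEG hC hS hB₂ hD hSR hP hT hCT hFT hCS
    hFS hTT hTS hBal hR1 hR2 hMet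
  rdef_of_grossU_edgeRelaxation_record (grossU_of_ceg_split (by norm_num) hCEG (elasticLiouvilleLaw_of_edgeRelaxationLaw hERL) hPG) hERL hCE hRes

/-- Sanity: cone XXXIX is cone XL's special case `hPG := grossLiouvilleLaw_of_…` — no: the two slot-1 hypotheses are INCOMPARABLE; what holds is
that BOTH cones are cases of the four-slot cone, e.g. cone XXXIX's slots 2–7d and ANY proof of slot 1 factor through RELAX at the record margin. -/
example (s₁ s₂ h₀ h₁ τ' τ'' κ' ω₀ ω B : ℝ) (s₀ : ℕ) (hκ' : 0 < κ') (hω : 0 < ω) (hω₀ : 2 * ω₀ ≤ ω) (hs₀ : 4 ≤ s₀) (hs₁ : 0 ≤ s₁)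
    (hs : 289 * s₂ ^ 2 ≤ 388 * s₁ ^ 2) (hG : GrossCleanBallsU (1 / 250) 10) (hCEG : ChargedEnergyGap) (hC : CompressedVirialLaw (1 / 250) 10)
    (hS : TwoShellShape (1 / 100) (3 / 50) (1 / 450)) (hB₂ : BarlowGluingW) (hD : DoorPeriodicW 2) (hSR : StackedReductionW 2 (17 / 16))
    (hP : RegistryPinningP (17 / 16) (1 / 40) (3 / 16) s₁ s₂ 1 0) (hT : TubeConvexRefP (17 / 16) (1 / 40) s₁ s₂ 1 0)
    (hCT : CoarseRegistryT (17 / 16) h₀ (3 / 20)) (hFT : ForceCertT h₀ (3 / 20) τ' ω₀) (hCS : CoarseRegistryS (17 / 16) h₁ (3 / 20))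
    (hFS : ForceCertS h₁ (3 / 20) τ'' ω₀) (hTT : AffineTableT (17 / 16) s₁ s₂ ω s₀ B (eStar + 2 * κ'))
    (hTS : AffineTableS (17 / 16) ω s₀ B (eStar + 2 * κ')) (hBal : BalancedLocus s₁ s₂ h₀ (1 / 40)) (hR1 : RegistryResidual s₁ s₂ (1 / 250))
    (hR2 : RegistryTube s₁ s₂ (1 / 100) 1) (hMet : RegistryMetricCW s₁ s₂ (3 / 500)) (hCE : CleanlessExcessT) (hRes : CoherentResidual 10) :
    RobustDefectLimitWindows :=
  rdef_of_grossU_edgeRelaxation_record hG (edgeRelaxationLaw_record_of_slots s₁ s₂ h₀ h₁ τ' τ'' κ' ω₀ ω B s₀ hκ' hω hω₀ hs₀ hs₁ hs hCEG hC hS hB₂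
    hD hSR hP hT hCT hFT hCS hFS hTT hTS hBal hR1 hR2 hMet) hCE hRes

/-! ## §7  The scale split degenerates at margin two -/

/-- Every uniformly discrete `9/10`-covering set has a «compressed clean scale» at margin `T₁ ≥ 2` (witness `a := 47/50`). [this file] -/
theorem hasCompressedScale_of_two_le {T₁ : ℝ} {Y : Set (EuclideanSpace ℝ (Fin 3))} (hT₁ : 2 ≤ T₁) (hY : UniformlyDiscrete Y)
    (hcov : ∀ z : EuclideanSpace ℝ (Fin 3), ∃ w ∈ Y, dist z w ≤ 9 / 10) : HasCompressedScale T₁ Y :=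
  ⟨47 / 50, le_rfl, by norm_num, fun y _ => rt_of_margin_two hY hcov le_rfl (by norm_num) hT₁ y⟩

/-- Hence the balanced Liouville law is VACUOUSLY true at margin `T₁ ≥ 2` — the generation-28 scale split carries no information there. [this file] -/
theorem balancedLiouvilleLaw_of_two_le {T₁ D : ℝ} (hT₁ : 2 ≤ T₁) : BalancedLiouvilleLaw T₁ D :=
  fun _ hY hnc => (hnc (hasCompressedScale_of_two_le hT₁ hY.1 hY.2.2.2.1)).elim

/-- … and at margin `T₁ ≥ 2` ELAS₂ is literally the compressed virial law's companion: `CompressedVirialLaw T₁ D → ElasticLiouvilleLaw 2 D`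
(but `CompressedVirialLaw T₁ D`, `T₁ ≥ 2`, asserts that EVERY gross recurrent texture is dilation-strained — false-type). [this file] -/
theorem elasticLiouvilleLaw_two_of_compressedVirialLaw {T₁ D : ℝ} (hT₁ : 2 ≤ T₁) (hC : CompressedVirialLaw T₁ D) : ElasticLiouvilleLaw 2 D :=
  (elasticLiouvilleLaw_iff_two hT₁).1 (elasticLiouvilleLaw_of_scaleSplit hC (balancedLiouvilleLaw_of_two_le hT₁))

end Summit.AtomisticToContinuum.Crystallization.Theorems.OverbindingBudgetGrossMargin

end
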